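import Summits.QuantumFields.YangMills.Theorems.VirialFluxGapRegularValleyPropagation
import Summits.QuantumFields.YangMills.Theorems.VirialFluxGapRingTwistEaterForm
import HarnessLib

/-!
# Route `VirialFluxGap` (YangMills): the toron valley is the GRAPH of the comb data — a flat ring history IS the comb-flat ring of its own comb data

Companion of ✓`RegularValley.regular_linear_localise` ∕ ✓`exists_central_flat_ring_near_of_central` ∕ ✓`regular_of_near_regular` (crux
⟨stmt-QuantumFields-24141⟩ `VirialFluxGap.PeriodicSoftness`).  The ε = 0 case of the comb skeleton of ✓`Lojasiewicz.exists_flat_ring_near`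
(fcl-p3 g33) is an EXACT PARAMETRISATION of the zero set of the periodic ring deficit — the valley the Euler field must be built around:

* (✓`RingDeficit.eq_of_fd_le_zero` — `‖V − W‖_F ≤ 0 ⟹ V = W` on `SU(2)`);
* ★★ `ringDeficit_eq_zero_iff_comb` — for every ring history `P` with comb transporter `t = treeGauge P₀`, wrap representatives `w = wrapReps P₀` and
  root seam value `c = P.2 0`:  `F₀(P) = 0` **iff**  the wraps pairwise commute, `c` commutes with the wraps, EVERY slice equals `t⁻¹·combFlat(w)`
  and the seam field is `x ↦ (t x)⁻¹·c·(t x)`.  So the valley `{F₀ = 0}` is the image of `(P₀-gauge t, commuting quadruple (w, c))`: per gauge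
  orbit a 6-parameter family (4 angles + the common axis), dimension `3L³ + 3`, codimension `18L⁴ − 3` in the `(18L⁴ + 3L³)`-dimensional ring
  space — the count behind `div X ≤ 18L⁴ − 3` of the Euler field and the exponent `9L⁴ − 3/2` of the volume law.

HONEST FRAMING: lattice bookkeeping; the Euler field, ⟨24141⟩, every rung and the Yang–Mills mass gap remain OPEN; no summit is proved by a line.
ROUTE-INDEPENDENT.  THEOREMS ONLY (no definition, no `sorry`), standard axioms.  Width seat `ym-line-sfw-p2-w2` g51 (cell ym-idea-1, free hands),
`--supports stmt-QuantumFields-24141`.  References: [cite: Luscher1983, §2]; [cite: SeilerLNP1982, §2].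
-/

set_option autoImplicit false

noncomputable section

open scoped Quaternion Matrix BigOperators
open Literature.MathematicalPhysics.QuantumFieldTheory hiding SU2
open Literature.MathematicalPhysics.QuantumLattice

namespace Summit.QuantumFields.YangMills.Theorems.VirialFluxGap.RegularValley

open Summit.QuantumFields.YangMills.Theorems.FemtoTransferGap
open Summit.QuantumFields.YangMills.Theorems.FemtoTransferGap.TT
open Summit.QuantumFields.YangMills.Theorems.FemtoTransferGap.TT.SectorSmooth
open Summit.QuantumFields.YangMills.Theorems.FemtoTransferGap.TwoLattice
open Summit.QuantumFields.YangMills.Theorems.FemtoTransferGap.TwoLattice.Flat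
open Summit.QuantumFields.YangMills.Theorems.FemtoTransferGap.TwoLattice.Cov
open Summit.QuantumFields.YangMills.Theorems.VirialFluxGap.RingDeficit
open Summit.QuantumFields.YangMills.Theorems.ToronValleyVolume.Lojasiewicz

variable {L : ℕ} [NeZero L]

omit [NeZero L] in
/-- A commutator of Frobenius distance `≤ 0` from `1` is trivial: `a b = b a`. [folklore] -/
theorem commute_of_fd_comm_le_zero {a b : SU2} (h : fd (a * b * a⁻¹ * b⁻¹) 1 ≤ 0) : a * b = b * a := by
  have h1 : a * b * a⁻¹ * b⁻¹ = 1 := eq_of_fd_le_zero h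
  calc a * b = a * b * a⁻¹ * b⁻¹ * (b * a) := by group
    _ = b * a := by rw [h1, one_mul]

/-- ★★ **The toron valley is the graph of the comb data.**  With `t = treeGauge P₀`, `w = wrapReps P₀`, `c = P.2 0`:  `F₀(P) = 0` iff the wraps
pairwise commute, `c` commutes with them, every slice is `t⁻¹·combFlat(w)` and the seam field is `x ↦ (t x)⁻¹ c (t x)`. [cite: Luscher1983, §2] -/
theorem ringDeficit_eq_zero_iff_comb (P : (Fin (2 * L - 1 + 1) → GaugeConfig 3 L SU2) × (Site 3 L → SU2)) :
    ringDeficit L (fun _ => false) P = 0 ↔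
      (∀ i j : Fin 3, wrapReps (P.1 0) i * wrapReps (P.1 0) j = wrapReps (P.1 0) j * wrapReps (P.1 0) i) ∧
      (∀ k : Fin 3, P.2 0 * wrapReps (P.1 0) k = wrapReps (P.1 0) k * P.2 0) ∧
      (∀ i : Fin (2 * L - 1 + 1), P.1 i = gaugeTransform (treeGauge (P.1 0))⁻¹ (combFlat (wrapReps (P.1 0)))) ∧
      (∀ x : Site 3 L, P.2 x = (treeGauge (P.1 0) x)⁻¹ * P.2 0 * treeGauge (P.1 0) x) := by
  have hL1 : (1 : ℝ) ≤ L := by exact_mod_cast NeZero.one_le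
  have hL0 : (0 : ℝ) ≤ (L : ℝ) - 1 := by linarith
  set U : GaugeConfig 3 L SU2 := P.1 0 with hU
  set g : Site 3 L → SU2 := P.2 with hg
  set t : Site 3 L → SU2 := treeGauge U with ht
  set w : Fin 3 → SU2 := wrapReps U with hw
  have hV : treeFix U = gaugeTransform t U := rfl
  constructor
  · intro h0
    obtain ⟨hall, hS0, hstab⟩ := (ringDeficit_eq_zero_iff (fun _ => false) P).mp h0
    rw [twist3_false] at hstab
    have hδ : Real.sqrt (ringDeficit L (fun _ => false) P) = 0 := by rw [h0, Real.sqrt_zero]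
    -- slice `0` in comb gauge is EXACTLY comb-flat
    have hSU : Real.sqrt (2 * wilsonAction su2Rep U) = 0 := by rw [hU, hS0, mul_zero, Real.sqrt_zero]
    have hVw : ∀ e, treeFix U e = combFlat w e := fun e => by
      refine eq_of_fd_le_zero ((fd_treeFix_combFlat_le U e).trans ?_)
      rw [hSU]; simp
    have hUeq : U = gaugeTransform t⁻¹ (combFlat w) := by
      have h1 : treeFix U = combFlat w := funext hVw
      rw [← h1, hV, gaugeTransform_inv_gaugeTransform]
    -- the wraps commute exactly
    have hww : ∀ i j, w i * w j = w j * w i := fun i j => by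
      refine commute_of_fd_comm_le_zero ((fd_comm_wrapReps_le U i j).trans ?_)
      rw [hSU, mul_zero]
    -- the seam: conjugated seam field is constant `= c`, and `c` commutes with the wraps (skeleton of ✓`exists_flat_ring_near` at `ε = 0`)
    have hseam : ∀ e, fd (U e) (gaugeTransform g U e) ≤ 0 := fun e => by
      have h := fd_seam_zero_le P e
      rw [hδ, mul_zero] at h
      exact h
    set sf : Site 3 L → SU2 := fun x => t x * g x * (t x)⁻¹ with hsf
    have hsV : ∀ e, fd (treeFix U e) (gaugeTransform sf (treeFix U) e) ≤ 0 := fun e => by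
      rw [hV, hsf, gaugeTransform_conj_eq, fd_gaugeTransform_apply]; exact hseam e
    have hjump : ∀ e : Edge 3 L, treeEdge e = true → fd (sf (e.1.shift e.2)) (sf e.1) ≤ 0 := by
      intro e he
      have h1 := hsV e
      rw [treeFix_eq_one_of_treeEdge U he] at h1
      have e1 : gaugeTransform sf (treeFix U) e = sf e.1 * (sf (e.1.shift e.2))⁻¹ := by
        rw [show gaugeTransform sf (treeFix U) e = sf e.1 * treeFix U e * (sf (e.1.shift e.2))⁻¹ from rfl, treeFix_eq_one_of_treeEdge U he, mul_one]
      rw [e1, fd_comm, fd_mul_inv_one] at h1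
      rwa [fd_comm]
    set c : SU2 := sf 0 with hc
    have hcg : c = g 0 := by rw [hc, hsf]; dsimp only; rw [ht, treeGauge_zero, one_mul, inv_one, mul_one]
    have hsc : ∀ x, sf x = c := fun x => by
      refine eq_of_fd_le_zero ?_
      have := fd_sub_base_le_of_treeEdge le_rfl hjump x
      rw [hc]; simpa using this
    have hcw : ∀ k : Fin 3, c * w k = w k * c := by
      intro k
      set m : Site 3 L := mk3 (if k = 0 then (-1 : ZMod L) else 0) (if k = 1 then (-1 : ZMod L) else 0) (if k = 2 then (-1 : ZMod L) else 0) with hm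
      have hwk : w k = treeFix U (m, k) := by rw [hw, wrapReps_eq]
      have hshift : m.shift k = 0 := wrapEdge_shift k
      have h1 := hsV (m, k)
      have e1 : gaugeTransform sf (treeFix U) (m, k) = sf m * treeFix U (m, k) * c⁻¹ := by
        rw [show gaugeTransform sf (treeFix U) (m, k) = sf m * treeFix U (m, k) * (sf (m.shift k))⁻¹ from rfl, hshift]
      rw [e1, ← hwk, hsc m] at h1
      -- `fd (w k) (c w c⁻¹) ≤ 0`
      have h2 : c * w k * c⁻¹ = w k := (eq_of_fd_le_zero h1).symm
      calc c * w k = c * w k * c⁻¹ * c := by group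
        _ = w k * c := by rw [h2]
    refine ⟨hww, fun k => by rw [← hcg]; exact hcw k, fun i => by rw [hall i]; exact hUeq, fun x => ?_⟩
    have hx := hsc x
    rw [hsf, hcg] at hx
    dsimp only at hx
    -- `t x * g x * (t x)⁻¹ = g 0` ⟹ `g x = (t x)⁻¹ * g 0 * t x`
    calc g x = (t x)⁻¹ * (t x * g x * (t x)⁻¹) * t x := by group
      _ = (t x)⁻¹ * g 0 * t x := by rw [hx]
  · rintro ⟨hww, hcw, hslices, hseam⟩
    -- `P` is the comb-flat ring of its own (commuting) comb data
    rw [ringDeficit_eq_sums, twist3_false]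
    have hP0 : P.1 0 = gaugeTransform t⁻¹ (combFlat w) := hslices 0
    have hlast : P.1 (Fin.last (2 * L - 1)) = gaugeTransform t⁻¹ (combFlat w) := hslices _
    have hg' : P.2 = fun x => (t x)⁻¹ * g 0 * t x := funext hseam
    have hcomb : ∀ k, g 0 * w k = w k * g 0 := hcw
    have hSF : wilsonAction su2Rep (combFlat w : GaugeConfig 3 L SU2) = 0 := wilsonAction_combFlat_eq_zero hww
    have hseamQ : gaugeTransform (fun x => (t x)⁻¹ * g 0 * t x) (gaugeTransform t⁻¹ (combFlat w)) = gaugeTransform t⁻¹ (combFlat w) := by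
      rw [gaugeTransform_gaugeTransform]
      have e1 : ((fun x => (t x)⁻¹ * g 0 * t x) * t⁻¹ : Site 3 L → SU2) = t⁻¹ * fun _ => g 0 := by
        funext x; simp only [Pi.mul_apply, Pi.inv_apply, mul_inv_cancel_right]
      rw [e1, ← gaugeTransform_gaugeTransform, gaugeTransform_const_combFlat_of_comm hcomb]
    have hkin : ∀ i : Fin (2 * L - 1), 6 * (L : ℝ) ^ 3 - timeCoupling su2Rep (P.1 i.castSucc) (P.1 i.succ) = 0 := fun i => by
      rw [hslices i.castSucc, hslices i.succ, timeCoupling_deficit_self]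
    have hSi : ∀ i : Fin (2 * L - 1 + 1), wilsonAction su2Rep (P.1 i) = 0 := fun i => by
      rw [hslices i, wilsonAction_gaugeTransform, hSF]
    rw [hg', hP0, hseamQ, hlast, timeCoupling_deficit_self, wilsonAction_gaugeTransform, hSF]
    simp [hkin, hSi]

end Summit.QuantumFields.YangMills.Theorems.VirialFluxGap.RegularValley

end
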